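import Summits.QuantumFields.BalabanUV.T4Continuum.Spine.NE1p.DressedRootComposition
import Summits.QuantumFields.BalabanUV.T4Continuum.Spine.NE1p.DressedStabilityOfSuppliedSchedules
import Summits.QuantumFields.BalabanUV.T4Continuum.Spine.NE1p.DressedBirthRStepAnchored

/-!
# T⁴ programme, spine estimate NE1′ (node O3b/H2) — THE COMPOSITION TERMINAL FACE: END-ALL ∘ suppliers ON THE END OF RECORD,
# with the L-V SOCKET (the value map PUSHES the scale-`k` fresh pairs into the birth frame: containment + felt-size contraction)

Cell `pub-balaban`, sub-cell `t4`, BINDER-OWNERS row NE1′ (owner lineage t4-ne1p-p1), formalisation crew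
`b2b-balaban-t4-ne1p-formalise-*`, seat `leaf-09` (gen 5; lineage S3 ∕ S3-sup ∕ S3k ∕ S3l); row S3u of `t4/formal/NE1p/LEAVES.md`
(INTENT `CLAIMS.log` l.12859; BOOKED typer R-T72 (i), conditions (a)–(h); X-label X87).  ADDITIVE — imports the owner's
`Spine/NE1p/DressedRootComposition` (N0e, p217849: the composition-route face over row S3-sup's `uniformConstantsOf` ∕ `bookingLeavesOf`),
the crew's row S3i `Spine/NE1p/DressedStabilityOfSuppliedSchedules` (p214477: `count_of_anchoring_cell` ∕ `positionalCount_of_anchoring_cell`;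
through it row S8 `DressedAttainment.hlin_of_lin_le_sSup`) and row S5e `Spine/NE1p/DressedBirthRStepAnchored` (p214587:
`hbirth_of_rstep_anchored`; through it rows S5 ∕ S5b ∕ S4) ONLY; THEOREMS ONLY (no `def`, no `def … : Prop`); modifies nothing.  NO
binder of the density layer (α′) enters the statements: no `wOp`, no `RealBaseAt` ∕ `ExponentSliceAt`, no `hP`, no `hdom`, no window
schedule (S3i's import cone contains that layer; nothing of it is named below).

WHY.  The dagwriter's RULING Q-NE1p-route (T4-DAG v28 §8 Q40, CLAIMS.log 12:37:59Z) makes the lineage's DETERMINISTIC END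
`T4TrajectoryComparison.transportsFromVar_of_response` leaf T's END OF RECORD, and the owner wired it (`DressedRootComposition`:
`transportLeaf_of_composition`, `dressedStabilityStrict_of_composition : DressedStabilityStrict 𝒯 (L ^ 4)`) with the structural
per-`(p, K)` families `hS`∕`hcount` (w3-book), `hbirth` (L-B), `hlin` (F-8) and the deterministic `hsl`∕`hrate` (L-V) DISPLAYED.  The
crew's END-ALL ∘ suppliers matrix (rows S3i … S3l.1) sits entirely on END-F (now the alternative (α′)).  This file is the same service
on the END of record, and types the owner's reading (memo `OWNER-ANSWERS-g24.md` §2bis (R7)(c): «the transported part F∘(value map) is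
not small but its FELT size at the next scale contracts») as a SOCKET:

* §1 THE L-V SOCKET (any trajectory, any gate).  The carried function of generation `(b, k′)` at every later scale IS its birth
  function `G b k′ : 𝒰 → F` on the birth frame (continuation factor `a = 1`: sups do not grow); what the scale-`k` step feeds it is a
  scale-`k` FRESH PAIR `(X₀, X₁)` of the scale-`k` configuration space `𝒳` (chart `moveX`, window norm `NX`, regular set `𝒦X k`,
  relation `relX k`, defect `δX k ≤ c_δ`), PUSHED into the birth frame by the value map `V b k′ k : 𝒳 → 𝒰`.  TWO EXPLICIT BINDERS
  carry the ONE new estimate (VAL-θ) of road P1 (printed TYPE only — [Balaban1987RGI] p. 307, [Balaban1989LargeFieldII] (1.65)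
  p. 375, [Balaban1988RGII] p. 15; road P2 ∕ P4 producers; asserted for Bałaban's maps NOWHERE; no `def … : Prop` minted, c3):
  (VAL-θ)-lite CONTAINMENT `hVK` — pushed base points land in the birth regular set `𝒦 b k′` (where F-1 gives analyticity with the
  birth radius `r`: «containment WITH margin»); (VAL-θ) FELT-SIZE CONTRACTION `hVrel` — a scale-`k` pair of defect `δ` is pushed to a
  pair in `RelGauge (rel b k′) move N` of defect `θ^(k−k′)·δ`, `0 ≤ θ ≤ L⁻²` the displayed depth ratio.  THE SOCKET ASKS NO
  ANALYTICITY OF THE VALUE MAP — only range and contraction of pairs; analyticity lives in F-1 AT BIRTH alone.  Lemmas: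
  `hsl_of_birthSlice` (F-1′ at all later scales from F-1 at birth, `a = 1`), `hrate_of_push` ∕ `hdefw_of_push` (F-6′ from the
  contraction exponent), `hlin_of_push` (F-8 from the BOOKING CONVENTION over pushed pairs — admissible scale-`k` pairs exist, the
  booked size is `≤ sSup` of the birth function's increments over pushed pairs — by S8's `exists_le_add_of_le_sSup` BY NAME),
  and `transportLeaf_of_valueMap` = the owner's `transportLeaf_of_composition_const` BY NAME at `a = 1` with the four produced families.
* §2 END-ALL ∘ SUPPLIERS ON THE END OF RECORD.  `dressedStabilityStrict_of_suppliedComposition : DressedStabilityStrict 𝒯 (L ^ 4)` —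
  the owner's `dressedStabilityStrict_of_composition` BY NAME, ONE application, `a = 1`, with `hS`∕`hcount` ⇐ the anchoring DATA (row
  S3i `count_of_anchoring_cell`), `hbirth` ⇐ THE ℝ-STEP ANCHORED SEAM (the births door of record since S3k.1 ∕ S3l.1: row S5e
  `hbirth_of_rstep_anchored` at `uniformConstantsOf L 1 (4c_δ∕r) c̄ …` — ONE `Rs p K : RStep` per run parameter and cutoff, its
  component volume `CompVol vR`, the pre-ℝ sizes below the transported envelope `PreBelowEnv`, the absorption law `AbsorbLaw` (w5b),
  dressing sizes `β j ≤ β₀·(L⁻³)^(K−j)`, row S5b's located numbers `fanout A (vR·mB) ρ′ < 1`, `absorbAmplitude β₀ A (vR·mB) ρ′ ≤ A₀`),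
  `hsl`∕`hdefw`∕`hrate`∕`hlin` ⇐ §1; then the headline `dressedStability_of_suppliedComposition` and ROOT-B
  `dressedBudget_of_suppliedComposition` (owner's `dressedStability_of_strict_comp` ∕ `dressedBudget_of_strict_comp` BY NAME, the
  bookings' positional count read off the SAME anchoring, S3i `positionalCount_of_anchoring_cell`).  Scalars ONCE before `∀ p K` (k1):
  `L c_δ r c̄ N₀ A₀ m s̄⁰ ρ′ θ v vR mB A β₀`,
  the located largeness `hloc : locOf L 1 (4c_δ∕r) c̄ ≤ ρ′ < 1` — NO `e³` (the owner's `one_lt_of_composition_cell`: (w7) forces only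
  `1 < L`), NO numeral `L` (k2: `Lb` is the anchoring's blocking integer with `(Lb:ℝ) = L`, a binder).

DISPLAYED, NEVER DISCHARGED (the walls of record, Q40 (d)): F-1 at birth (w1) `hG`, the two value-map binders `hVK`∕`hVrel` (L-V =
(VAL-θ)-lite + (VAL-θ), road P2 ∕ P4 producers; `CovariantMeanLatticeDepth.depthRatio` is the intended `θ` — NOT imported, NOT
asserted), the booking convention `hneX`∕`hsupX` (F-8's reading), (w5) `hreg`, (w5b) `hlaw` with the seam `hpre` and sizes `hβ`, margins
`hs₀` (free to be `≡ 0` on this route), the anchoring ∕ component ∕ ℝ-step DATA; the PAY ∕ allowance arithmetic is the owner's N0d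
`DressedSigmaRoute` and does not enter here.  Headline (c4): «ROOT-C OF RECORD ⇐ F-1 at birth ∧
the two value-map binders ∧ (w5)∕(w5b) ∧ anchoring∕absorption DATA — NE1′ NOT proved; (VAL-θ) is the ONE new estimate, DISPLAYED».

HONEST FRAMING.  Kernel REDUCTION ∕ bookkeeping over hypothesis SHAPES; (VAL-θ) NOT discharged; 0 binders instantiated on Bałaban's
densities or value maps; whether the dressed run may be booked on the polymer route at every step is the owner's READING ruled of record by
Q40 with t4-ref2's second reading OWED — not a theorem.  [folklore] kernel glue + one real-analysis fact (S8), 0 sorry, 0 citations used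
as facts.  NE1′ NOT printed, NOT proved; spine PROVED 0∕9.  Rung (B)+1 on ONE finite four-torus — NOT infinite volume, NOT a mass gap, NOT
OS on ℝ⁴, NOT Clay.  HONEST DEPENDENCY: continuum YM on T⁴ ⇐ BetaPertH ∧ nine spine estimates (0/9 proved); BetaPertH ⇐ (D1) ∧ (D4) ∧
CAP+tail; G-an2-4 gates asym, D1 and NE2/3/4.
-/

noncomputable section

namespace Summit.QuantumFields.BalabanUV.T4Continuum.NE1p.DressedStabilityStrictOfSuppliedComposition

open Set Finset
open scoped BigOperators
open Literature.MathematicalPhysics.QuantumFieldTheory.Balaban1983to89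
open Literature.MathematicalPhysics.QuantumFieldTheory.Balaban1983to89.T4TermFormat
open Literature.MathematicalPhysics.QuantumFieldTheory.Balaban1983to89.T4FeltGeometry
open Literature.MathematicalPhysics.QuantumFieldTheory.Balaban1983to89.T4TrajectoryComparison
open Literature.MathematicalPhysics.QuantumFieldTheory.Balaban1983to89.T4BirthChartTransport
  (GaugeInvariant BirthSlice RelGauge)
open Summit.QuantumFields.BalabanUV.T4Continuum.T4TrajectoryDensityDressed
open Summit.QuantumFields.BalabanUV.T4Continuum.NE1p.DressedRoot
open Summit.QuantumFields.BalabanUV.T4Continuum.NE1p.DressedUniformConstants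
open Summit.QuantumFields.BalabanUV.T4Continuum.NE1p.DressedRootComposition
open Literature.MathematicalPhysics.QuantumFieldTheory.Balaban1983to89.T4PreservedUnderR (RStep)
open Summit.QuantumFields.BalabanUV.T4Continuum.NE1p.DressedBirthSuppliers
open Summit.QuantumFields.BalabanUV.T4Continuum.NE1p.DressedAbsorptionWindow
open Summit.QuantumFields.BalabanUV.T4Continuum.NE1p.DressedPositionalCount
open Summit.QuantumFields.BalabanUV.T4Continuum.NE1p.DressedAttainment
open Summit.QuantumFields.BalabanUV.T4Continuum.NE1p.DressedBirthRStepAnchored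
open Summit.QuantumFields.BalabanUV.T4Continuum.NE1p.DressedStabilityOfSuppliedSchedules

/-! ## §1 THE L-V SOCKET: the carried function is the birth function, the scale-`k` fresh pairs are PUSHED by the value map -/

section Socket

variable {B : T4TermFormat.Booking} {T : Trajectory B} {Gate : ℕ → Prop}
variable {𝒰 Dir F : Type*} [NormedAddCommGroup F] {move : 𝒰 → Dir → ℂ → 𝒰} {N : Dir → ℝ} {w r : ℝ}
variable {𝒳 DirX : Type*} {moveX : 𝒳 → DirX → ℂ → 𝒳} {NX : DirX → ℝ}
variable {G : B.Birth → ℕ → 𝒰 → F} {rel : B.Birth → ℕ → 𝒰 → 𝒰 → Prop} {𝒦 : B.Birth → ℕ → Set 𝒰}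
  {V : B.Birth → ℕ → ℕ → 𝒳 → 𝒰} {𝒦X : ℕ → Set 𝒳} {relX : ℕ → 𝒳 → 𝒳 → Prop} {δX : ℕ → ℝ} {θ cδ ψ : ℝ}

/-- **F-1′ AT EVERY LATER SCALE FROM F-1 AT BIRTH** [bookkeeping]: on the composition route the carried function of generation
`(b, k′)` at scale `k ≥ k′` IS the birth function `G b k′` (the value map acts on the PAIRS, §1's reading; continuation factor
`a = 1`), so the END's slice binder at scale `k` — under the longer history `RanBelow Gate k` — is the birth slice itself
(`RanBelow.mono`, `1 ^ (k − k′) = 1`). [folklore] -/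
theorem hsl_of_birthSlice [NormedSpace ℂ F]
    (hG : ∀ (b : B.Birth) (k' : ℕ), B.birthScale b ≤ k' → k' ≤ B.K → RanBelow Gate k' →
      BirthSlice (G b k') move N (𝒦 b k') w r (T.gen b k')) :
    ∀ (b : B.Birth) (k' k : ℕ), B.birthScale b ≤ k' → k' ≤ k → k ≤ B.K → RanBelow Gate k →
      BirthSlice ((fun b k' (_ : ℕ) => G b k') b k' k) move N (𝒦 b k') w r ((1 : ℝ) ^ (k - k') * T.gen b k') := by
  intro b k' k hb hk' hk hran
  rw [one_pow, one_mul]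
  exact hG b k' hb (hk'.trans hk) (hran.mono hk')

/-- **F-6′ FROM THE CONTRACTION EXPONENT** [arith]: the pushed defect `θ^(k−k′)·δX k` with `0 ≤ θ ≤ ψ` and `0 ≤ δX k ≤ c_δ` is
`≤ c_δ·ψ^(k−k′)` — the END's rate binder at the cell's transverse rate `ψ` (`= L⁻²`). [folklore] -/
theorem hrate_of_push (hθ0 : 0 ≤ θ) (hθψ : θ ≤ ψ) (hδ0 : ∀ k, 0 ≤ δX k) (hδc : ∀ k, δX k ≤ cδ) :
    ∀ (b : B.Birth) (k' k : ℕ), B.birthScale b ≤ k' → k' ≤ k → k ≤ B.K →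
      (fun (_ : B.Birth) (k' k : ℕ) => θ ^ (k - k') * δX k) b k' k ≤ cδ * ψ ^ (k - k') := by
  intro b k' k _ _ _
  show θ ^ (k - k') * δX k ≤ cδ * ψ ^ (k - k')
  rw [mul_comm]
  exact mul_le_mul (hδc k) (pow_le_pow_left₀ hθ0 hθψ _) (pow_nonneg hθ0 _) ((hδ0 k).trans (hδc k))

/-- **THE PUSHED DEFECT STAYS INSIDE THE WINDOW** [arith]: `θ^(k−k′)·δX k ≤ w` from `δX k ≤ w`, `0 ≤ δX k`, `0 ≤ θ ≤ 1`. [folklore] -/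
theorem hdefw_of_push (hθ0 : 0 ≤ θ) (hθ1 : θ ≤ 1) (hδ0 : ∀ k, 0 ≤ δX k) (hδw : ∀ k, δX k ≤ w) :
    ∀ (b : B.Birth) (k' k : ℕ), (fun (_ : B.Birth) (k' k : ℕ) => θ ^ (k - k') * δX k) b k' k ≤ w := by
  intro b k' k
  show θ ^ (k - k') * δX k ≤ w
  calc θ ^ (k - k') * δX k ≤ 1 * δX k := mul_le_mul_of_nonneg_right (pow_le_one₀ hθ0 hθ1) (hδ0 k)
    _ = δX k := one_mul _
    _ ≤ w := hδw k

/-- **F-8 FROM THE BOOKING CONVENTION OVER THE SCALE-`k` PAIRS, PUSHED** [bookkeeping]: under the history, (i) SOME admissible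
scale-`k` pair exists (`X₀ ∈ 𝒦X k`, `X₁` in `relX k`-gauge of defect `δX k` along `moveX`), (ii) the booked size `T.lin b k′ k` is at
most the supremum of the COMPOSED function's increments `‖G b k′ (V b k′ k X₁) − G b k′ (V b k′ k X₀)‖` over such pairs (the
convention `lin := sSup …` gives equality) — row S8's `hlin_of_lin_le_sSup` BY NAME on the scale-`k` side (carried function
`G b k′ ∘ V b k′ k`, any gate) yields an ε-attaining scale-`k` pair; the value map's CONTAINMENT (`hVK`) and FELT-SIZE CONTRACTION
(`hVrel`) push it into the birth frame — EXACTLY the END's attainment binder for `Fn b k′ k := G b k′` and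
`defect b k′ k := θ^(k−k′)·δX k`. [folklore] -/
theorem hlin_of_push
    (hVK : ∀ (b : B.Birth) (k' k : ℕ), B.birthScale b ≤ k' → k' ≤ k → k ≤ B.K → ∀ X₀ ∈ 𝒦X k, V b k' k X₀ ∈ 𝒦 b k')
    (hVrel : ∀ (b : B.Birth) (k' k : ℕ), B.birthScale b ≤ k' → k' ≤ k → k ≤ B.K → ∀ X₀ ∈ 𝒦X k, ∀ X₁ : 𝒳, ∀ δ : ℝ,
      RelGauge (relX k) moveX NX X₀ X₁ δ → RelGauge (rel b k') move N (V b k' k X₀) (V b k' k X₁) (θ ^ (k - k') * δ))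
    (hneX : ∀ (b : B.Birth) (k' k : ℕ), B.birthScale b ≤ k' → k' ≤ k → k ≤ B.K → RanBelow Gate k →
      ∃ X₀ ∈ 𝒦X k, ∃ X₁ : 𝒳, RelGauge (relX k) moveX NX X₀ X₁ (δX k))
    (hsupX : ∀ (b : B.Birth) (k' k : ℕ), B.birthScale b ≤ k' → k' ≤ k → k ≤ B.K → RanBelow Gate k →
      T.lin b k' k ≤ sSup {x : ℝ | ∃ X₀ ∈ 𝒦X k, ∃ X₁ : 𝒳,
        RelGauge (relX k) moveX NX X₀ X₁ (δX k) ∧ x = ‖G b k' (V b k' k X₁) - G b k' (V b k' k X₀)‖}) :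
    ∀ (b : B.Birth) (k' k : ℕ), B.birthScale b ≤ k' → k' ≤ k → k ≤ B.K → RanBelow Gate k → ∀ ε > 0,
      ∃ U₀ ∈ 𝒦 b k', ∃ U₁ : 𝒰, RelGauge (rel b k') move N U₀ U₁ ((fun (_ : B.Birth) (k' k : ℕ) => θ ^ (k - k') * δX k) b k' k) ∧
        T.lin b k' k ≤ ‖(fun b k' (_ : ℕ) => G b k') b k' k U₁ - (fun b k' (_ : ℕ) => G b k') b k' k U₀‖ + ε := by
  intro b k' k hb hk' hk hran ε hε
  -- row S8's attainment on the scale-`k` side, for the COMPOSED function `G b k′ ∘ V b k′ k`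
  obtain ⟨X₀, hX₀, X₁, hrelX, hle⟩ :=
    hlin_of_lin_le_sSup (T := T) (Gate := Gate) (Fn := fun b k' k X => G b k' (V b k' k X))
      (rel := fun (_ : B.Birth) (_ k : ℕ) => relX k) (move := moveX) (N := NX) (𝒦 := fun (_ : B.Birth) (_ k : ℕ) => 𝒦X k)
      (defect := fun (_ : B.Birth) (_ k : ℕ) => δX k) hneX hsupX b k' k hb hk' hk hran ε hε
  -- push the ε-attaining pair into the birth frame
  exact ⟨V b k' k X₀, hVK b k' k hb hk' hk X₀ hX₀, V b k' k X₁, hVrel b k' k hb hk' hk X₀ hX₀ X₁ (δX k) hrelX, hle⟩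

/-- **THE COMPOSED TRANSPORT LEAF THROUGH THE SOCKET** [bookkeeping]: `BookingLeaves.htr`'s field type at `C = 4c_δ∕r`, constant rate `ψ·1`,
gated by the dressed budget — the owner's `transportLeaf_of_composition_const` BY NAME at `a = 1`, its four deterministic families
supplied by `hsl_of_birthSlice` ∕ `hdefw_of_push` ∕ `hrate_of_push` ∕ `hlin_of_push`.  Displayed: F-1 at birth `hG`, F-9′ `hinv`∕`hmove`,
the value-map binders `hVK`∕`hVrel` (L-V), the booking convention `hneX`∕`hsupX`, the signs `0 ≤ θ ≤ ψ ≤ 1`, `0 ≤ δX ≤ c_δ`, `δX ≤ w`.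
[folklore] -/
theorem composedLeaf_of_valueMap [NormedSpace ℂ F] [CompleteSpace F] {m : ℝ} {s : B.Birth → ℕ → ℝ} {S : ℕ → B.Birth → Finset B.Birth}
    (hG : ∀ (b : B.Birth) (k' : ℕ), B.birthScale b ≤ k' → k' ≤ B.K →
      RanBelow (budgetGate T s m S (4 * cδ / r) (fun _ : ℕ => ψ * 1)) k' →
      BirthSlice (G b k') move N (𝒦 b k') w r (T.gen b k'))
    (hinv : ∀ b k', GaugeInvariant (rel b k') (G b k')) (hmove : ∀ U d, move U d 0 = U) (hr : 0 < r)
    (hθ0 : 0 ≤ θ) (hθψ : θ ≤ ψ) (hψ1 : ψ ≤ 1) (hδ0 : ∀ k, 0 ≤ δX k) (hδc : ∀ k, δX k ≤ cδ) (hδw : ∀ k, δX k ≤ w)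
    (hVK : ∀ (b : B.Birth) (k' k : ℕ), B.birthScale b ≤ k' → k' ≤ k → k ≤ B.K → ∀ X₀ ∈ 𝒦X k, V b k' k X₀ ∈ 𝒦 b k')
    (hVrel : ∀ (b : B.Birth) (k' k : ℕ), B.birthScale b ≤ k' → k' ≤ k → k ≤ B.K → ∀ X₀ ∈ 𝒦X k, ∀ X₁ : 𝒳, ∀ δ : ℝ,
      RelGauge (relX k) moveX NX X₀ X₁ δ → RelGauge (rel b k') move N (V b k' k X₀) (V b k' k X₁) (θ ^ (k - k') * δ))
    (hneX : ∀ (b : B.Birth) (k' k : ℕ), B.birthScale b ≤ k' → k' ≤ k → k ≤ B.K →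
      RanBelow (budgetGate T s m S (4 * cδ / r) (fun _ : ℕ => ψ * 1)) k →
      ∃ X₀ ∈ 𝒦X k, ∃ X₁ : 𝒳, RelGauge (relX k) moveX NX X₀ X₁ (δX k))
    (hsupX : ∀ (b : B.Birth) (k' k : ℕ), B.birthScale b ≤ k' → k' ≤ k → k ≤ B.K →
      RanBelow (budgetGate T s m S (4 * cδ / r) (fun _ : ℕ => ψ * 1)) k →
      T.lin b k' k ≤ sSup {x : ℝ | ∃ X₀ ∈ 𝒦X k, ∃ X₁ : 𝒳,
        RelGauge (relX k) moveX NX X₀ X₁ (δX k) ∧ x = ‖G b k' (V b k' k X₁) - G b k' (V b k' k X₀)‖}) :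
    T.TransportsFromVar (4 * cδ / r) (fun _ : ℕ => ψ * 1)
      (budgetGate T s m S (4 * cδ / r) (fun _ : ℕ => ψ * 1)) :=
  transportLeaf_of_composition_const (T := T) (Fn := fun b k' (_ : ℕ) => G b k')
    (defect := fun (_ : B.Birth) (k' k : ℕ) => θ ^ (k - k') * δX k) zero_le_one
    (fun b k' _ => hinv b k') (hsl_of_birthSlice hG) hmove hr (hdefw_of_push hθ0 (hθψ.trans hψ1) hδ0 hδw)
    (hrate_of_push hθ0 hθψ hδ0 hδc) (hlin_of_push hVK hVrel hneX hsupX)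

end Socket

/-! ## §2 END-ALL ∘ SUPPLIERS ON THE END OF RECORD: ROOT-C of record, the headline, ROOT-B -/

section EndAll

variable {P : Type*} (𝒯 : DressedTower P)
variable {𝒰 Dir F : Type*} [NormedAddCommGroup F] [NormedSpace ℂ F] [CompleteSpace F]
  {move : 𝒰 → Dir → ℂ → 𝒰} {N : Dir → ℝ} {w r : ℝ}
variable {𝒳 DirX : Type*} {moveX : 𝒳 → DirX → ℂ → 𝒳} {NX : DirX → ℝ}
variable {L cδ cbar N₀ A₀ m sbar ρ' θ A β₀ : ℝ} {Lb mB v vR : ℕ}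
-- the function-level data per run parameter and cutoff: birth functions, birth relations ∕ regular sets, the value maps, the
-- scale-`k` configuration data (regular sets, relations, fresh defects)
variable {G : ∀ (p : P) (K : ℕ), (𝒯.B p K).Birth → ℕ → 𝒰 → F}
  {rel : ∀ (p : P) (K : ℕ), (𝒯.B p K).Birth → ℕ → 𝒰 → 𝒰 → Prop}
  {𝒦 : ∀ (p : P) (K : ℕ), (𝒯.B p K).Birth → ℕ → Set 𝒰}
  {V : ∀ (p : P) (K : ℕ), (𝒯.B p K).Birth → ℕ → ℕ → 𝒳 → 𝒰}
  {𝒦X : P → ℕ → ℕ → Set 𝒳} {relX : P → ℕ → ℕ → 𝒳 → 𝒳 → Prop} {δX : P → ℕ → ℕ → ℝ}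
-- the booking-level data: regeneration constants, margins, live families, anchoring, components, the ℝ-steps, dressing sizes
variable {c : P → ℕ → ℕ → ℝ} {s₀ : ∀ (p : P) (K : ℕ), (𝒯.B p K).Birth → ℕ → ℝ}
  {S : ∀ (p : P) (K : ℕ), ℕ → (𝒯.B p K).Birth → Finset (𝒯.B p K).Birth}
variable (Anch : ∀ (p : P) (K : ℕ), Anchoring (𝒯.B p K) 4 Lb)
  {comp : ∀ (p : P) (K : ℕ), ℕ → (𝒯.B p K).Birth → Finset (𝒯.B p K).Cube}
  (Rs : ∀ (p : P) (K : ℕ), RStep (𝒯.B p K))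
  {β : P → ℕ → ℕ → ℝ}

-- the located scalars ((w7) largeness WITHOUT `e³`, (w6) window) and signs — ONCE
variable (hL : 1 ≤ L) (hcδ : 0 ≤ cδ) (hr : 0 < r) (hcbar : 0 ≤ cbar) (hN₀ : 0 ≤ N₀) (hA₀ : 0 ≤ A₀) (hm : 0 ≤ m)
variable (hloc : locOf L 1 (4 * cδ / r) cbar ≤ ρ') (hρ'1 : ρ' < 1) (hsmall : m * (N₀ * A₀ * (1 - ρ')⁻¹) ≤ 1 - sbar)
-- the depth ratio and the scale-`k` fresh defects: signs and sizes — ONCE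
variable (hθ0 : 0 ≤ θ) (hθL : θ ≤ (L ^ 2)⁻¹)
variable (hδ0 : ∀ p K k, 0 ≤ δX p K k) (hδc : ∀ p K k, δX p K k ≤ cδ) (hδw : ∀ p K k, δX p K k ≤ w)
-- (w1) F-1 AT THE BIRTH SCALE ONLY, F-9′, the chart
variable (hG : ∀ (p : P) (K : ℕ) (b : (𝒯.B p K).Birth) (k' : ℕ), (𝒯.B p K).birthScale b ≤ k' → k' ≤ (𝒯.B p K).K →
  RanBelow (budgetGate (𝒯.T p K) (s₀ p K) m (S p K) (4 * cδ / r) (fun _ : ℕ => (L ^ 2)⁻¹ * 1)) k' →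
  BirthSlice (G p K b k') move N (𝒦 p K b k') w r ((𝒯.T p K).gen b k'))
variable (hinv : ∀ p K b k', GaugeInvariant (rel p K b k') (G p K b k')) (hmove : ∀ U d, move U d 0 = U)
-- L-V: THE TWO VALUE-MAP BINDERS `hVK` ((VAL-θ)-lite containment) ∕ `hVrel` ((VAL-θ) felt-size contraction) sit in each theorem's
-- HEADER below (the face's signature content; statements header-distinct from the (α′) faces' header-less ENDs)
-- F-8's reading: THE BOOKING CONVENTION over the scale-`k` pairs (composed function)
variable (hneX : ∀ (p : P) (K : ℕ) (b : (𝒯.B p K).Birth) (k' k : ℕ), (𝒯.B p K).birthScale b ≤ k' → k' ≤ k →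
  k ≤ (𝒯.B p K).K → RanBelow (budgetGate (𝒯.T p K) (s₀ p K) m (S p K) (4 * cδ / r) (fun _ : ℕ => (L ^ 2)⁻¹ * 1)) k →
  ∃ X₀ ∈ 𝒦X p K k, ∃ X₁ : 𝒳, RelGauge (relX p K k) moveX NX X₀ X₁ (δX p K k))
variable (hsupX : ∀ (p : P) (K : ℕ) (b : (𝒯.B p K).Birth) (k' k : ℕ), (𝒯.B p K).birthScale b ≤ k' → k' ≤ k →
  k ≤ (𝒯.B p K).K → RanBelow (budgetGate (𝒯.T p K) (s₀ p K) m (S p K) (4 * cδ / r) (fun _ : ℕ => (L ^ 2)⁻¹ * 1)) k →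
  (𝒯.T p K).lin b k' k ≤ sSup {x : ℝ | ∃ X₀ ∈ 𝒦X p K k, ∃ X₁ : 𝒳, RelGauge (relX p K k) moveX NX X₀ X₁ (δX p K k) ∧
    x = ‖G p K b k' (V p K b k' k X₁) - G p K b k' (V p K b k' k X₀)‖})
-- (w5) regeneration, margins
variable (hc0 : ∀ p K k, 0 ≤ c p K k) (hcb : ∀ p K k, k < (𝒯.B p K).K → c p K k ≤ cbar)
variable (hs₀ : ∀ p K b k, s₀ p K b k ≤ sbar)
variable (hreg : ∀ p K, (𝒯.T p K).RegeneratesFromVar (c p K)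
  (budgetGate (𝒯.T p K) (s₀ p K) m (S p K) (4 * cδ / r) (fun _ : ℕ => (L ^ 2)⁻¹ * 1)))
-- (w3-book) L-C REPLACED BY ANCHORING DATA (row S4): blocking integer, multiplicity, housing, component volume
variable (hLb : (Lb : ℝ) = L)
variable (hmult : ∀ (p : P) (K : ℕ), ∀ j (x : Fin 4 → ℕ),
  ((𝒯.B p K).births.filter fun b => (𝒯.B p K).birthScale b = j ∧ x ∈ (Anch p K).dom b).card ≤ mB)
variable (hscale : ∀ (p : P) (K : ℕ), ∀ k b, ∀ q ∈ comp p K k b, (𝒯.B p K).cubeScale q = k)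
variable (hhoused : ∀ (p : P) (K : ℕ), ∀ k b, ∀ f ∈ S p K k b, ∃ q ∈ comp p K k b, f ∈ (𝒯.B p K).feltAt q)
variable (hvol : ∀ (p : P) (K : ℕ), ∀ k b, (comp p K k b).card ≤ v) (hvN₀ : (v : ℝ) * mB ≤ N₀)
-- (w1)+(w5b) L-B THROUGH THE ℝ-STEP ANCHORED SEAM (row S5e): component volume, pre-ℝ sizes below the envelope, absorption law, sizes
variable (hcv : ∀ (p : P) (K : ℕ), (Rs p K).CompVol vR)
variable (hpre : ∀ (p : P) (K : ℕ), (𝒯.T p K).PreBelowEnv (Rs p K) (4 * cδ / r) (fun _ : ℕ => (L ^ 2)⁻¹ * 1)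
  (budgetGate (𝒯.T p K) (s₀ p K) m (S p K) (4 * cδ / r) (fun _ : ℕ => (L ^ 2)⁻¹ * 1)))
variable (hA : 0 ≤ A) (hlaw : ∀ (p : P) (K : ℕ), (𝒯.T p K).AbsorbLaw (Rs p K) (4 * cδ / r) (β p K) A)
variable (hβ : ∀ (p : P) (K : ℕ), ∀ j, j ≤ (𝒯.B p K).K → β p K j ≤ β₀ * (L⁻¹ ^ 3) ^ ((𝒯.B p K).K - j))
variable (hfan : fanout A ((vR : ℝ) * mB) ρ' < 1) (hamp : absorbAmplitude β₀ A ((vR : ℝ) * mB) ρ' ≤ A₀)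

include hL hcδ hr hcbar hN₀ hA₀ hm hloc hρ'1 hsmall hθ0 hθL hδ0 hδc hδw hG hinv hmove hneX hsupX hc0 hcb hs₀ hreg hLb hmult hscale
  hhoused hvol hvN₀ hcv hpre hA hlaw hβ hfan hamp

/-- **ROOT-C OF RECORD ON THE END OF RECORD, SUPPLIERS WIRED** [bookkeeping]: the owner's `dressedStabilityStrict_of_composition`
BY NAME (ONE application, continuation factor `a = 1`) with its structural per-`(p, K)` families SUPPLIED — `hS`∕`hcount` from the
anchoring (row S3i `count_of_anchoring_cell`), `hbirth` from the ℝ-step anchored seam at `uniformConstantsOf L 1 (4c_δ∕r) c̄ …`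
(row S5e `hbirth_of_rstep_anchored`: absorbed families counted through the ℝ-step's component geometry and the anchoring; row S5b
`absorbSmall_of_le` at `vR·mB`), and the four deterministic families `hsl`∕`hdefw`∕`hrate`∕`hlin` from §1's L-V SOCKET
(`Fn p K b k′ k := G p K b k′`, `defect p K b k′ k := θ^(k−k′)·δX p K k`).  The scalars precede `∀ p K` (k1).  DISPLAYED: F-1 at birth,
`hVK`∕`hVrel` (L-V = (VAL-θ)-lite ∕ (VAL-θ), NOT asserted), the booking convention, (w5) `hreg`, (w5b) `hlaw` with `hpre`∕`hβ`,
anchoring ∕ component ∕ ℝ-step DATA.  «ROOT-C ⇐ the named binders», NOT «NE1′ proved». [folklore] -/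
theorem dressedStabilityStrict_of_suppliedComposition
    (hVK : ∀ (p : P) (K : ℕ) (b : (𝒯.B p K).Birth) (k' k : ℕ), (𝒯.B p K).birthScale b ≤ k' → k' ≤ k →
      k ≤ (𝒯.B p K).K → ∀ X₀ ∈ 𝒦X p K k, V p K b k' k X₀ ∈ 𝒦 p K b k')
    (hVrel : ∀ (p : P) (K : ℕ) (b : (𝒯.B p K).Birth) (k' k : ℕ), (𝒯.B p K).birthScale b ≤ k' → k' ≤ k →
      k ≤ (𝒯.B p K).K → ∀ X₀ ∈ 𝒦X p K k, ∀ X₁ : 𝒳, ∀ δ : ℝ, RelGauge (relX p K k) moveX NX X₀ X₁ δ →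
        RelGauge (rel p K b k') move N (V p K b k' k X₀) (V p K b k' k X₁) (θ ^ (k - k') * δ)) :
    DressedStabilityStrict 𝒯 (L ^ 4) := by
  have hC : 0 ≤ 4 * cδ / r := by positivity
  have hψ1 : (L ^ 2)⁻¹ ≤ 1 := inv_le_one_of_one_le₀ (one_le_pow₀ hL)
  have hLb0 : 0 < Lb := by
    have h : (0 : ℝ) < (Lb : ℝ) := by rw [hLb]; linarith
    exact_mod_cast h
  have hsm : β₀ + A * ((vR : ℝ) * mB) * A₀ * (1 - ρ')⁻¹ ≤ A₀ := absorbSmall_of_le hfan hamp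
  exact dressedStabilityStrict_of_composition 𝒯 hL zero_le_one hcδ hr hcbar hN₀ hA₀ hm hloc hρ'1 hsmall c s₀ S hc0 hcb
    (fun p K => (count_of_anchoring_cell (Anch p K) hLb hL (hmult p K) (hscale p K) (hhoused p K) (hvol p K) hvN₀).1)
    (fun p K => (count_of_anchoring_cell (Anch p K) hLb hL (hmult p K) (hscale p K) (hhoused p K) (hvol p K) hvN₀).2) hs₀
    (fun p K => hbirth_of_rstep_anchored
      (uniformConstantsOf L 1 (4 * cδ / r) cbar N₀ A₀ m sbar ρ' hL zero_le_one hC hcbar hN₀ hA₀ hm hloc hρ'1 hsmall)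
      (𝒯.T p K) (Rs p K) (fun _ : ℕ => (L ^ 2)⁻¹ * 1) (s₀ p K) (S p K) (Anch p K) hLb0 (hmult p K) (hcv p K)
      (by rw [uniformConstantsOf_Λ, ← hLb]) hA (hpre p K) (hlaw p K) (hβ p K) hsm)
    hreg (fun p K b k' (_ : ℕ) => G p K b k') rel 𝒦 (fun p K (_ : (𝒯.B p K).Birth) (k' k : ℕ) => θ ^ (k - k') * δX p K k)
    (fun p K b k' _ => hinv p K b k') (fun p K => hsl_of_birthSlice (hG p K)) hmove
    (fun p K => hdefw_of_push hθ0 (hθL.trans hψ1) (hδ0 p K) (hδw p K))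
    (fun p K => hrate_of_push hθ0 hθL (hδ0 p K) (hδc p K))
    (fun p K => hlin_of_push (hVK p K) (hVrel p K) (hneX p K) (hsupX p K))

/-- **THE HEADLINE ROOT ON THE END OF RECORD** [bookkeeping]: `DressedStability 𝒯` from the strict root (owner's
`dressedStability_of_strict_comp` BY NAME). [folklore] -/
theorem dressedStability_of_suppliedComposition
    (hVK : ∀ (p : P) (K : ℕ) (b : (𝒯.B p K).Birth) (k' k : ℕ), (𝒯.B p K).birthScale b ≤ k' → k' ≤ k →
      k ≤ (𝒯.B p K).K → ∀ X₀ ∈ 𝒦X p K k, V p K b k' k X₀ ∈ 𝒦 p K b k')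
    (hVrel : ∀ (p : P) (K : ℕ) (b : (𝒯.B p K).Birth) (k' k : ℕ), (𝒯.B p K).birthScale b ≤ k' → k' ≤ k →
      k ≤ (𝒯.B p K).K → ∀ X₀ ∈ 𝒦X p K k, ∀ X₁ : 𝒳, ∀ δ : ℝ, RelGauge (relX p K k) moveX NX X₀ X₁ δ →
        RelGauge (rel p K b k') move N (V p K b k' k X₀) (V p K b k' k X₁) (θ ^ (k - k') * δ)) :
    DressedStability 𝒯 :=
  dressedStability_of_strict_comp
    (dressedStabilityStrict_of_suppliedComposition 𝒯 Anch Rs hL hcδ hr hcbar hN₀ hA₀ hm hloc hρ'1 hsmall hθ0 hθL hδ0 hδc hδw hG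
      hinv hmove hneX hsupX hc0 hcb hs₀ hreg hLb hmult hscale hhoused hvol hvN₀ hcv hpre hA hlaw hβ hfan hamp hVK hVrel)

/-- **ROOT-B ON THE END OF RECORD** [bookkeeping]: with nonnegative cube weights bounded by `w̄` and the bookings' positional count
read off the SAME anchoring (row S3i `positionalCount_of_anchoring_cell`, `1 ≤ v` so that `mB ≤ v·mB ≤ N₀`), `DressedBudget 𝒯 wt` —
the owner's `dressedBudget_of_strict_comp` BY NAME. [folklore] -/
theorem dressedBudget_of_suppliedComposition
    (hVK : ∀ (p : P) (K : ℕ) (b : (𝒯.B p K).Birth) (k' k : ℕ), (𝒯.B p K).birthScale b ≤ k' → k' ≤ k →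
      k ≤ (𝒯.B p K).K → ∀ X₀ ∈ 𝒦X p K k, V p K b k' k X₀ ∈ 𝒦 p K b k')
    (hVrel : ∀ (p : P) (K : ℕ) (b : (𝒯.B p K).Birth) (k' k : ℕ), (𝒯.B p K).birthScale b ≤ k' → k' ≤ k →
      k ≤ (𝒯.B p K).K → ∀ X₀ ∈ 𝒦X p K k, ∀ X₁ : 𝒳, ∀ δ : ℝ, RelGauge (relX p K k) moveX NX X₀ X₁ δ →
        RelGauge (rel p K b k') move N (V p K b k' k X₀) (V p K b k' k X₁) (θ ^ (k - k') * δ))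
    {wt : P → ℕ → ℕ → ℝ} {wbar : ℝ} (hwbar : 0 ≤ wbar)
    (hw0 : ∀ p K, ∀ j ≤ K, 0 ≤ wt p K j) (hwb : ∀ p K, ∀ j ≤ K, wt p K j ≤ wbar) (hv : 1 ≤ v) :
    DressedBudget 𝒯 wt :=
  have hmN₀ : (mB : ℝ) ≤ N₀ := by
    have h1 : (1 : ℝ) ≤ (v : ℝ) := by exact_mod_cast hv
    have hmB : (0 : ℝ) ≤ (mB : ℝ) := by positivity
    nlinarith
  dressedBudget_of_strict_comp
    (dressedStabilityStrict_of_suppliedComposition 𝒯 Anch Rs hL hcδ hr hcbar hN₀ hA₀ hm hloc hρ'1 hsmall hθ0 hθL hδ0 hδc hδw hG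
      hinv hmove hneX hsupX hc0 hcb hs₀ hreg hLb hmult hscale hhoused hvol hvN₀ hcv hpre hA hlaw hβ hfan hamp hVK hVrel)
    hN₀ hwbar hw0 hwb fun p K => positionalCount_of_anchoring_cell (Anch p K) hLb hL (hmult p K) hmN₀

end EndAll

end Summit.QuantumFields.BalabanUV.T4Continuum.NE1p.DressedStabilityStrictOfSuppliedComposition

end
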